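import Mathlib

/-!
# `BalabanImbrieJaffe1984to88.BIJ88Sect5StatementsPart2` — T. Bałaban, J. Imbrie, A. Jaffe, *Effective action and cluster
properties of the abelian Higgs model*, Commun. Math. Phys. **114** (1988) 257–315 [BalabanImbrieJaffe1988]: Sect. 5, part 2 —
the STATED BOUNDS of the inductive step ((5.4.7), (5.5.5), (5.6.13), (5.7.6), (5.7.9), (5.7.14), p. 298, (5.9.3)–(5.9.5), (5.11.1),
(5.11.3), p. 303, p. 307, (5.14.4), pp. 310–311) as `Prop` leaves over a schematic polymer/lattice bookkeeping

statement-level skeleton of published theorems with citation tags; proofs where landed; nothing here is a claim about the Yang–Mills mass gap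

PDF held: `paper:balaban1988-cmp114-bij-abelian-higgs-effective-action` (journal page = PDF page + 256).  Renders read as images:
PDF pp. 21–58 (journal 277–314), `g4png.py` ×2 (r16 seat folder `scratch/c2pages/`).

CITATION HEADER (lean-in-tree rule).  Part of the lit-balaban TYPED SKELETON (HOME `run/shared/lean/pub/lit-balaban/`; rows
`C2.Eq5.4.7`, `C2.Eq5.5.5`, `C2.Eq5.6.13`, `C2.Eq5.7.5-5.7.6`, `C2.Eq5.7.7-5.7.9`, `C2.Eq5.7.13-5.7.15`, `C2.Def§5.10`, `C2.Eq5.9.3`,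
`C2.Eq5.9.4-5.9.5`, `C2.Eq5.11.1`, `C2.Eq5.11.3`, `C2.Eq5.13.1-5.13.2`, `C2.Claim@307`, `C2.Eq5.14.3-5.14.4`, `C2.Claim@310` of
`HOME/lit-balaban-r16/ROWS-C2-part2.md`; companion of `BIJ88Sect5Statements` (the definitions and the proved identities of Sect. 5)).
WHAT IS REPRODUCED, and how (ref-1 F6, schematic typing): Sect. 5 states its bounds for kernels w(x,b), for terms W(□) localized in
r(e_k)-cubes □ and for polymer activities W(X), g(X) indexed by connected unions X of r(e_k)-cubes, in terms of |X| (number of cubes),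
|X|^− = max{0, |X| − 1} (p. 290), the running charges e_j, r(e_k), p(e_k), and the "vertex factor" e^β(L^kε/ε₀)^{1/4−α} (p. 298:
*"each vertex results in at least a factor e^β(L^kε/ε₀)^{1/4−α}"*).  These index sets and numbers are carried ABSTRACTLY
(`PolymerSys`: a type of polymers with a cube count; cubes, sites, bonds as bare types; the region-membership conditions "b ∈ Λ^{(k)′*}_0"
etc. as predicates; the large-field volumes |B_{k−j−1}(X) ∩ Λ^{(j)′}_5 ∩ Λ^{(j+1)c}_6| as a function `lfVol`), and each printed
inequality is a `def … : Prop` over them, verbatim in its exponents and constants; the objects themselves (the kernels of Sects. 2–4,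
the fields after the translations (5.3.1)/(5.5.2)/(5.8.1), the Mayer covering sums) are NOT constructed here — a consumer instantiates
the carrier.  PROVED: the bookkeeping |X|^− = max{0,|X|−1} and e^{−c|X|} ≤ e^{−c|X|^−}; the combined bound on W₄^{(k)}(X) (display
before (5.11.1)) FROM (5.11.1) and the printed decomposition, by the triangle inequality (`ineqW4_of_5111`).  PRINT NOTE recorded, not
adjudicated: (5.11.1)/(5.11.3) print the factor `[e^β(L^kε/ε₀)]^{n̄+1}` WITHOUT the exponent 1/4−α that the W₄-bound four lines above and
p. 298 carry; typed as printed, with the constant a free parameter.  NOTHING of the paper is asserted.  Unit `lit-balaban-r16`.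
-/

namespace Literature.MathematicalPhysics.QuantumFieldTheory.BalabanImbrieJaffe1984to88.BIJ88Sect5StatementsPart2

/-! ## Bookkeeping: polymers, |X|, |X|^−, the vertex factor -/

/-- The polymer bookkeeping of Sects. 5.7–5.15 (p. 289: *"X's are arbitrary connected unions of r(e_k)-cubes"*; p. 295: *"X runs
over connected unions of r(e_k)-cubes in T₁^{(k)}"*): a type of polymers with the cube count |X|.
[cite: BalabanImbrieJaffe1988, (5.7.5) p.289] -/
structure PolymerSys where
  /-- the polymers X -/
  Poly : Type
  /-- |X| = the number of r(e_k)-cubes in X -/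
  card : Poly → ℕ

namespace PolymerSys

variable (P : PolymerSys)

/-- p. 290 [PDF 34], verbatim: *"Here we define |X|^− = max{0, |X| − 1}"* (natural-number subtraction).
[cite: BalabanImbrieJaffe1988, (5.7.7) p.290] -/
def cardMinus (X : P.Poly) : ℕ := P.card X - 1

/-- `|X|^−` is the printed `max{0, |X| − 1}`. [cite: BalabanImbrieJaffe1988, (5.7.7) p.290] -/
theorem cardMinus_eq_max (X : P.Poly) : (P.cardMinus X : ℝ) = max 0 ((P.card X : ℝ) - 1) := by
  unfold cardMinus
  rcases Nat.eq_zero_or_pos (P.card X) with h | h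
  · simp [h]
  · have h1 : (1 : ℝ) ≤ P.card X := by exact_mod_cast h
    rw [Nat.cast_sub h, Nat.cast_one, max_eq_right (by linarith)]

/-- The |X|-decay is stronger than the |X|^−-decay (for a non-negative rate): e^{−a|X|} ≤ e^{−a|X|^−}.  (Why (5.7.14)/(5.11.1) may
mix the two.) [cite: BalabanImbrieJaffe1988, (5.7.9) p.291] -/
theorem exp_card_le_exp_cardMinus {a : ℝ} (ha : 0 ≤ a) (X : P.Poly) :
    Real.exp (-a * P.card X) ≤ Real.exp (-a * P.cardMinus X) := by
  apply Real.exp_le_exp.mpr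
  have : (P.cardMinus X : ℝ) ≤ P.card X := by exact_mod_cast Nat.sub_le _ _
  nlinarith

end PolymerSys

/-- p. 298 [PDF 42], verbatim: *"each vertex results in at least a factor e^β(L^kε/ε₀)^{1/4−α}"* — the vertex factor, as a function of
β, s = L^kε/ε₀ and α (real power). [cite: BalabanImbrieJaffe1988, p.298 (Sect. 5.10)] -/
noncomputable def vertexFactor (β s α : ℝ) : ℝ :=
  Real.exp β * s ^ (1 / 4 - α)

/-- The vertex factor is positive for s > 0. [cite: BalabanImbrieJaffe1988, p.298 (Sect. 5.10)] -/
theorem vertexFactor_pos (β α : ℝ) {s : ℝ} (hs : 0 < s) : 0 < vertexFactor β s α := by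
  unfold vertexFactor
  exact mul_pos (Real.exp_pos β) (Real.rpow_pos_of_pos hs _)

/-! ## Kernel bounds (5.4.7), (5.5.5) -/

/-- **(5.4.7)** p. 282 [PDF 26], verbatim: *"The scalar fields appear as φ(x)exp[ie_k(w₂A′)(x)], ψ(y)exp[ie_k(w₂A′)(y)], where w₂ =
Λ̄₃^{(k)}C_{k,loc} − Λ̄₃^{(k)}C_k□ satisfies a bound |w₂(x,b)| ≤ exp(−cr(e_k)) exp(−c dist(x,b)), (5.4.7)"* (p. 283: *"[this follows from
(2.26)]"*) — over bare site/bond types with a distance function; `rk` = r(e_k).  The same shape is printed on p. 282 for ∂w′₁ (*"≤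
e^{−cr(e_k)}e^{−c dist(p,b′)}, and similarly for w′₁, ∂*w′₁"*) and for w₁. [cite: BalabanImbrieJaffe1988, (5.4.7) p.282] -/
def Ineq547 (Site Bond : Type) (w₂ : Site → Bond → ℝ) (dist : Site → Bond → ℝ) (c rk : ℝ) : Prop :=
  ∀ x b, |w₂ x b| ≤ Real.exp (-(c * rk)) * Real.exp (-(c * dist x b))

/-- **(5.5.5)** p. 284 [PDF 28], verbatim: *"… The kernels w′₃, w″₃ have range less than ½r(e_k), and we have |w′₃(p,b)|, |w″₃(p,b)|
≤ e^{−cr(e_k)}. (5.5.5)"* — the bound (the range clause is a property of the carrier, not typed). [cite: BalabanImbrieJaffe1988, (5.5.5) p.284] -/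
def Ineq555 (Plaq Bond : Type) (w₃' w₃'' : Plaq → Bond → ℝ) (c rk : ℝ) : Prop :=
  ∀ p b, |w₃' p b| ≤ Real.exp (-(c * rk)) ∧ |w₃'' p b| ≤ Real.exp (-(c * rk))

/-! ## Localized terms: (5.6.13), p. 298, p. 304 -/

/-- **(5.6.13)** p. 288 [PDF 32], the bound clause, verbatim: *"Here W₁^{(k)}(□) is localized near □, an r(e_k)-cube in Λ₂^{(k)}, and
|W₁^{(k)}(□)| ≤ e_k^{n̄−1−α}"* — over a bare type of cubes; `ek` = e_k, real exponent n̄ − 1 − α. [cite: BalabanImbrieJaffe1988, (5.6.13) p.288] -/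
def Ineq5613 (Cube : Type) (W₁ : Cube → ℝ) (ek : ℝ) (nbar : ℕ) (α : ℝ) : Prop :=
  ∀ X : Cube, |W₁ X| ≤ ek ^ ((nbar : ℝ) - 1 - α)

/-- **p. 298** [PDF 42] (Sect. 5.10), verbatim: *"The terms W₃^{(k)}(□) contain terms localized near the r(e_k)-cube □ which involve the
small kernel w₈ or have high powers of coupling constants. We have an estimate |W₃^{(k)}(□)| ≤ [e^β(L^kε/ε₀)^{1/4−α}]^{n̄+1} ≤
e^{n̄β}(L^kε/ε₀)^κ, with κ > d as large as desired if n̄ > n̄(κ)."* — the first inequality, with θ = the vertex factor.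
[cite: BalabanImbrieJaffe1988, p.298 (Sect. 5.10)] -/
def IneqW3 (Cube : Type) (W₃ : Cube → ℝ) (θ : ℝ) (nbar : ℕ) : Prop :=
  ∀ X : Cube, |W₃ X| ≤ θ ^ (nbar + 1)

/-- **p. 303** [PDF 47] (Sect. 5.13), verbatim: *"we obtain a decomposition. V^{(k)}(Λ₈^{(k)}, u_{k+1}, A^{(k)}, φ^{(k)}) = Σ_Y V^{(k)}(Y) +
V^{(k)}_{const}(Λ₈^{(k)}). The last term includes all terms independent of A^{(k)}, φ^{(k)}. We have an estimate |V^{(k)}(Y)| ≤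
e^β(L^kε/ε₀)^{1/4−α}. Note that Y contains at most a few cubes."* [cite: BalabanImbrieJaffe1988, p.303 (Sect. 5.13)] -/
def IneqVY (Loc : Type) (V : Loc → ℝ) (θ : ℝ) : Prop :=
  ∀ Y : Loc, |V Y| ≤ θ

/-! ## Polymer activities of the normalization factors: (5.7.6), (5.7.9), (5.7.14) -/

/-- **(5.7.6)** p. 290 [PDF 34], verbatim: *"where compatible means that b₁, …, b_m, b were associated to X as above. We have |A′(b_l)| ≤
cp(e_k), |w₅(b,b_l)| ≤ e^{−cr(e_k)}e^{−c dist(b,b_l)} and so |w_{b,m}(X)| ≤ e^{−cr(e_k)|X|}. (5.7.6)"* — for the localized pieces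
w_{b,m}(X) of (5.7.5), at fixed b, m. [cite: BalabanImbrieJaffe1988, (5.7.6) p.290] -/
def Ineq576 (P : PolymerSys) (w : P.Poly → ℝ) (c rk : ℝ) : Prop :=
  ∀ X, |w X| ≤ Real.exp (-(c * rk) * P.card X)

/-- **(5.7.9)** p. 291 [PDF 35], verbatim: *"|W^{(j)′}(X)| ≤ e_j^{n̄+1−α} e^{−cr(e_k)|X|^−} (r(e_k)L^{k−j})^d |X| ≤ e_j^κ
e^{−cr(e_k)|X|^−}. (5.7.9) We can take κ arbitrarily large by increasing n̄."* — both printed inequalities, with `ej` = e_j,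
`rk` = r(e_k), `Lkj` = L^{k−j}.
TYPED-READING NOTE (v1.5, owner r16; HOME/GAPS.md G-C2-p36-03): this leaf reads the print with ONE letter `c` in both
exponentials; so read, the second conjunct is `W'`-free arithmetic demanding `|X| ≤ e_j^{κ−(n̄+1−α)}/(r_kL^{k−j})^d` for every
polymer, which is unsatisfiable as soon as `|X|` is unbounded (`BIJ88Ineq579Second.not_ineq579_of_unbounded`, p250757).  The
paper's `c` is a generic rate allowed to decrease from line to line; the printed sentence is PROVED in that (two-constant) reading
as `BIJ88Ineq579Second.ineq579_second` (second rate `c/2`, κ = n̄ + 1 − α − 2d/(4−d) − θ explicit), which is the statement of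
record for row C2.Eq5.7.7-5.7.9; this verbatim leaf is kept unchanged for its importers. [cite: BalabanImbrieJaffe1988, (5.7.9) p.291] -/
def Ineq579 (P : PolymerSys) (W' : P.Poly → ℝ) (ej rk Lkj : ℝ) (d nbar : ℕ) (α κ c : ℝ) : Prop :=
  ∀ X, |W' X| ≤ ej ^ ((nbar : ℝ) + 1 - α) * Real.exp (-(c * rk) * P.cardMinus X) * (rk * Lkj) ^ d * P.card X
    ∧ ej ^ ((nbar : ℝ) + 1 - α) * Real.exp (-(c * rk) * P.cardMinus X) * (rk * Lkj) ^ d * P.card X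
        ≤ ej ^ κ * Real.exp (-(c * rk) * P.cardMinus X)

/-- **(5.7.14)** p. 295 [PDF 39], verbatim: *"where X is a connected union of r(e_k)-cubes in T₁^{(k)}, W₂^{(k)}(X) = Σ_{j=0}^{k} W^{(j)′}(X) +
… + W^{(j)(vi)}(X), |W₂^{(k)}(X)| ≤ e_k^κ e^{−cr(e_k)|X|^−} + Σ_{j<k} e_j^{1−α} e^{−cr(e_k)|X|} |B_{k−j−1}(X) ∩ Λ₅^{(j)′} ∩ Λ₆^{(j+1)c}|,
(5.7.14)"* — `e : ℕ → ℝ` the running charges, `lfVol j X` the printed volume |B_{k−j−1}(X) ∩ Λ₅^{(j)′} ∩ Λ₆^{(j+1)c}| (p. 292: *"we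
will see later that this is beaten by small factors coming from large fields"*). [cite: BalabanImbrieJaffe1988, (5.7.14) p.295] -/
def Ineq5714 (P : PolymerSys) (W₂ : P.Poly → ℝ) (k : ℕ) (e : ℕ → ℝ) (lfVol : ℕ → P.Poly → ℕ) (κ α c rk : ℝ) : Prop :=
  ∀ X, |W₂ X| ≤ e k ^ κ * Real.exp (-(c * rk) * P.cardMinus X)
    + ∑ j ∈ Finset.range k, e j ^ (1 - α) * Real.exp (-(c * rk) * P.card X) * lfVol j X

/-! ## Field bounds (5.9.3)–(5.9.5) -/

/-- **(5.9.3)** p. 296 [PDF 40], verbatim: *"we wish to prove that |u_{k+1}(⟨b₋,b₊⟩)ψ(b₊) − ψ(b₋)| ≡ |(D_{ū_{k+1}}ψ)(b)| ≤ cp(e_k),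
b ∈ Λ₀^{(k)′*}. (5.9.3)"* (proved pp. 296–297 from the restrictions (5.2.2) and the smallness of the change u_k → u_{k+1}); typed for
the bond function b ↦ (D_{ū_{k+1}}ψ)(b) with the region as a predicate; `pek` = p(e_k). [cite: BalabanImbrieJaffe1988, (5.9.3) p.296] -/
def Ineq593 (Bond : Type) (inRegion : Bond → Prop) (Dψ : Bond → ℂ) (c pek : ℝ) : Prop :=
  ∀ b, inRegion b → ‖Dψ b‖ ≤ c * pek

/-- **(5.9.4)** p. 297 [PDF 41], verbatim: *"We remarked earlier that A′ is small in Λ₁^{(k)*}. We then defined A^{(k)} = A′ +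
Λ₄^{(k)*}L^{−2}C^{(k)}_{loc}H*_{k,loc}∂*Q^{e*}_{k+1}f. Since f is small and H_{k,loc} is regular, we have that |A_b^{(k)}| ≤ cp(e_k),
b ∈ Λ₁^{(k)*}. (5.9.4)"* [cite: BalabanImbrieJaffe1988, (5.9.4) p.297] -/
def Ineq594 (Bond : Type) (inRegion : Bond → Prop) (A : Bond → ℝ) (c pek : ℝ) : Prop :=
  ∀ b, inRegion b → |A b| ≤ c * pek

/-- **(5.9.5)** p. 297 [PDF 41], verbatim: *"(the corresponding statement with C^{(k)}(u_{k+1}) was proven in [8, Eq. (2.113)]. Using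
arguments like the ones we used to bound D_{ū_{k+1}}ψ, we can replace Q(u_{k+1})*ψ with φ in this bound. This proves that |φ^{(k)}(x)|
≤ cp(e_k), x ∈ Λ₇^{(k)*}. (5.9.5)"* ([8] = Bałaban, (Higgs)₂,₃ II, CMP 86 — a DEPGRAPH edge, not a hypothesis).
[cite: BalabanImbrieJaffe1988, (5.9.5) p.297] -/
def Ineq595 (Site : Type) (inRegion : Site → Prop) (φ : Site → ℂ) (c pek : ℝ) : Prop :=
  ∀ x, inRegion x → ‖φ x‖ ≤ c * pek

/-! ## The Mayer expansion I: (5.11.1), the combined W₄ bound, (5.11.3) -/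

/-- **(5.11.1)** p. 299 [PDF 43], verbatim: *"W₄^{(k)}(X) = Σ_{j<k} Σ_{x_j ∈ B_{k−j−1}(X)∩Λ₅^{(j)′}∩Λ₆^{(j+1)c}} W_{4,j}^{(k)}(x_j, X) +
W_{4,k}^{(k)}(x_k, X). Here x_k is some distinguished point in X (for unity of notation) and |W_{4,j}^{(k)}(x_j, X)| ≤ e_j^{1−α}
e^{−cr(e_k)|X|}, |W_{4,k}^{(k)}(x_k, X)| ≤ [e^β(L^kε/ε₀)]^{n̄+1} e^{−cr(e_k)|X|^−}. (5.11.1)"* — `W₄ⱼ j x X` for j < k, `W₄ₖ X` for the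
j = k term; `K` = the printed constant e^β(L^kε/ε₀) (sic: printed here WITHOUT the exponent 1/4−α of p. 298 — typed as a free
parameter). [cite: BalabanImbrieJaffe1988, (5.11.1) p.299] -/
def Ineq5111 (P : PolymerSys) (Pt : Type) (k : ℕ) (W₄ⱼ : ℕ → Pt → P.Poly → ℝ) (W₄ₖ : P.Poly → ℝ) (e : ℕ → ℝ)
    (α c rk K : ℝ) (nbar : ℕ) : Prop :=
  (∀ j, j < k → ∀ x X, |W₄ⱼ j x X| ≤ e j ^ (1 - α) * Real.exp (-(c * rk) * P.card X)) ∧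
  (∀ X, |W₄ₖ X| ≤ K ^ (nbar + 1) * Real.exp (-(c * rk) * P.cardMinus X))

/-- The combined bound printed four lines before (5.11.1), p. 299 [PDF 43], verbatim: *"|W₄^{(k)}(X)| ≤ [e^β(L^kε/ε₀)^{1/4−α}]^{n̄+1}
e^{−cr(e_k)|X|^−} + Σ_{j<k} e_j^{1−α} e^{−cr(e_k)|X|} |B_{k−j−1}(X) ∩ Λ₅^{(j)′} ∩ Λ₆^{(j+1)c}|"* — with the first constant a parameter
`K` (see the sic in `Ineq5111`) and `lfVol j X` = |B_{k−j−1}(X) ∩ Λ₅^{(j)′} ∩ Λ₆^{(j+1)c}|. [cite: BalabanImbrieJaffe1988, (5.11.1) p.299] -/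
def IneqW4 (P : PolymerSys) (k : ℕ) (W₄ : P.Poly → ℝ) (e : ℕ → ℝ) (lfVol : ℕ → P.Poly → ℕ) (α c rk K : ℝ) (nbar : ℕ) : Prop :=
  ∀ X, |W₄ X| ≤ K ^ (nbar + 1) * Real.exp (-(c * rk) * P.cardMinus X)
    + ∑ j ∈ Finset.range k, e j ^ (1 - α) * Real.exp (-(c * rk) * P.card X) * lfVol j X

/-- Bookkeeping PROVED: the printed decomposition of W₄^{(k)}(X) (sum over j < k and over the points x_j of a set of size
|B_{k−j−1}(X)∩Λ₅^{(j)′}∩Λ₆^{(j+1)c}|, plus the j = k term) together with (5.11.1) gives the combined bound `IneqW4`, by the triangle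
inequality. [cite: BalabanImbrieJaffe1988, (5.11.1) p.299] -/
theorem ineqW4_of_5111 (P : PolymerSys) (Pt : Type) (k : ℕ) (W₄ⱼ : ℕ → Pt → P.Poly → ℝ) (W₄ₖ W₄ : P.Poly → ℝ) (e : ℕ → ℝ)
    (pts : ℕ → P.Poly → Finset Pt) (α c rk K : ℝ) (nbar : ℕ)
    (hdec : ∀ X, W₄ X = (∑ j ∈ Finset.range k, ∑ x ∈ pts j X, W₄ⱼ j x X) + W₄ₖ X)
    (h : Ineq5111 P Pt k W₄ⱼ W₄ₖ e α c rk K nbar) :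
    IneqW4 P k W₄ e (fun j X => (pts j X).card) α c rk K nbar := by
  intro X
  obtain ⟨hj, hk⟩ := h
  rw [hdec X]
  have hsum : |∑ j ∈ Finset.range k, ∑ x ∈ pts j X, W₄ⱼ j x X|
      ≤ ∑ j ∈ Finset.range k, e j ^ (1 - α) * Real.exp (-(c * rk) * P.card X) * ((pts j X).card : ℕ) := by
    refine (Finset.abs_sum_le_sum_abs _ _).trans (Finset.sum_le_sum fun j hjk => ?_)
    have hjlt : j < k := Finset.mem_range.mp hjk
    refine (Finset.abs_sum_le_sum_abs _ _).trans ?_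
    calc ∑ x ∈ pts j X, |W₄ⱼ j x X|
        ≤ ∑ _x ∈ pts j X, e j ^ (1 - α) * Real.exp (-(c * rk) * P.card X) :=
          Finset.sum_le_sum fun x _ => hj j hjlt x X
      _ = e j ^ (1 - α) * Real.exp (-(c * rk) * P.card X) * ((pts j X).card : ℕ) := by
          rw [Finset.sum_const, nsmul_eq_mul]; ring
  calc |(∑ j ∈ Finset.range k, ∑ x ∈ pts j X, W₄ⱼ j x X) + W₄ₖ X|
      ≤ |∑ j ∈ Finset.range k, ∑ x ∈ pts j X, W₄ⱼ j x X| + |W₄ₖ X| := abs_add_le _ _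
    _ ≤ (∑ j ∈ Finset.range k, e j ^ (1 - α) * Real.exp (-(c * rk) * P.card X) * ((pts j X).card : ℕ))
        + K ^ (nbar + 1) * Real.exp (-(c * rk) * P.cardMinus X) := add_le_add hsum (hk X)
    _ = _ := by ring

/-- **(5.11.3)** p. 299 [PDF 43], verbatim: *"|Σ_{S₄ = {(j_α, x_{j,α}, X_α)}: ∪_α X_α = X} Π_α (e^{−W_{4,j}^{(k)}(x_{j,α}, X_α)} − 1)| ≤
exp(Σ_{j<k} e_j^{1−α} e^{−cr(e_k)} |B_{k−j−1}(X) ∩ Λ₅^{(j)′} ∩ Λ₆^{(j+1)c}|) [e^β(L^kε/ε₀)]^{(n̄+1)|X|}. (5.11.3)"* — the "typical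
estimate"; the covering sum on the left is carried as an abstract functional `mayerSum X` (F6: the combinatorics of the coverings
S₄ is not modelled), `K` = e^β(L^kε/ε₀) as printed (sic, cf. `Ineq5111`). [cite: BalabanImbrieJaffe1988, (5.11.3) p.299] -/
def Ineq5113 (P : PolymerSys) (k : ℕ) (mayerSum : P.Poly → ℝ) (e : ℕ → ℝ) (lfVol : ℕ → P.Poly → ℕ) (α c rk K : ℝ)
    (nbar : ℕ) : Prop :=
  ∀ X, |mayerSum X| ≤ Real.exp (∑ j ∈ Finset.range k, e j ^ (1 - α) * Real.exp (-(c * rk)) * lfVol j X)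
    * K ^ ((nbar + 1) * P.card X)

/-! ## The decoupling estimate p. 307, (5.14.4), the remainders W₆ pp. 310–311 -/

/-- **p. 307** [PDF 51] (Sect. 5.13), verbatim: *"In sum, we have the following bound or [sic] g₂(X_α): |g₂(X_α)| ≤
exp[(e^β(L^kε/ε₀)^{1/4−α})^{β′}(|X_α ∩ Λ₁₁^{(k)c}| + 1)] × Π_{σ₁}(L^kε)^{−m̃(σ₁)} (e^β(L^kε/ε₀)^{1/4−α})^{β′|X_α∖Λ₁₁^{(k)c}|}. The product over
σ₁ runs over σ₁ ∈ σ̃₁ such that X_{σ₁} ⊂ X_α or X_{σ₁} is in a component of Λ₁₁^{(k)c} overlapping X_α."* (β′ > 0 introduced five lines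
earlier with the combinatoric factors exp((e^β(L^kε/ε₀)^{1/4−α})^{β′}|X_α|)) — θ = the vertex factor; `volLF X` = |X ∩ Λ₁₁^{(k)c}|,
`volSF X` = |X ∖ Λ₁₁^{(k)c}| (cube counts), `obs X` = the printed observable product Π_{σ₁}(L^kε)^{−m̃(σ₁)} (abstract; the last power
of the vertex factor is read OUTSIDE the product over σ₁). [cite: BalabanImbrieJaffe1988, p.307 (Sect. 5.13)] -/
def Ineq307 (P : PolymerSys) (g₂ : P.Poly → ℝ) (volLF volSF : P.Poly → ℕ) (obs : P.Poly → ℝ) (θ β' : ℝ) : Prop :=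
  ∀ X, |g₂ X| ≤ Real.exp (θ ^ β' * ((volLF X : ℝ) + 1)) * obs X * θ ^ (β' * volSF X)

/-- **p. 307** [PDF 51], the refined case, verbatim: *"If |X_α| = 1, with no F^{m̄}_{k,loc}-factors, then we have the more precise bound
|g₂(X_α) − 1| ≤ e^β(L^kε/ε₀)^{1/4−α}, obtained from the same estimates on the S_Y, S₅ sums, and from extremely small factors when a
χ′-factor is replaced by 1."* — `noF X` = "no F^{m̄}_{k,loc}-factors in X". [cite: BalabanImbrieJaffe1988, p.307 (Sect. 5.13)] -/
def Ineq307unit (P : PolymerSys) (g₂ : P.Poly → ℝ) (noF : P.Poly → Prop) (θ : ℝ) : Prop :=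
  ∀ X, P.card X = 1 → noF X → |g₂ X - 1| ≤ θ

/-- **(5.14.4)** p. 309 [PDF 53], verbatim: *"Let us drop the prime, and prove that |g₃(H_β, X_β)| ≤ (e^β(L^kε/ε₀)^{1/4−α})^{[|H_β| +
β′|X_β∖H_β|]}. (5.14.4) We use X_β∖H_β to denote the set of cubes with no (d/dt)_{γ_j} factors, j ∈ H_β."* (p. 309: *"Here H_β ⊂ H
specifies which (d/dt)_{γ_j} have supports intersecting X_β"*, H ⊂ {1, …, n̄+1}) — `Lab` the type of the label sets H, `nH H` = |H_β|,
`nRest H X` = |X_β ∖ H_β|, θ = the vertex factor. [cite: BalabanImbrieJaffe1988, (5.14.4) p.309] -/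
def Ineq5144 (P : PolymerSys) (Lab : Type) (g₃ : Lab → P.Poly → ℝ) (nH : Lab → ℕ) (nRest : Lab → P.Poly → ℕ) (θ β' : ℝ) :
    Prop :=
  ∀ H X, |g₃ H X| ≤ θ ^ ((nH H : ℝ) + β' * nRest H X)

/-- **p. 310** [PDF 54] (Sect. 5.14), verbatim: *"ℛ_k(Λ₁₂^{(k)}) = Σ_{X⊂Λ₁₂^{(k)}} W₆^{(k)′}(X). Here W₆^{(k)′}(X) is obtained by summing
only over {X_γ}, (Y₁, …, Y_B) which fill X, … It is now a standard exercise to estimate the expansion, using (5.14.4). The result is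
|W₆^{(k)′}(X)| ≤ (e^β(L^kε/ε₀)^{1/4−α})^{n̄+1+β′|X|}. (We allow adjustments in β, α, β′, keeping them small.)"*
[cite: BalabanImbrieJaffe1988, p.310 (Sect. 5.14)] -/
def IneqW6' (P : PolymerSys) (W₆' : P.Poly → ℝ) (θ β' : ℝ) (nbar : ℕ) : Prop :=
  ∀ X, |W₆' X| ≤ θ ^ ((nbar : ℝ) + 1 + β' * P.card X)

/-- **p. 311** [PDF 55] (Sect. 5.14), verbatim: *"If we put W₆^{(k)}(X) = W₆^{(k)′}(X) + W₆^{(k)″}(X), then W₆^{(k)}(X) obeys |W₆^{(k)}(X)| ≤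
(e^β(L^kε/ε₀)^{1/4−α})^{n̄+1+β′|X|}, dist(X, Λ₁₂^{(k),c}) ≥ r(e_k); (e^β(L^kε/ε₀)^{1/4−α})^{β′|X|}, otherwise."* — `far X` = "dist(X,
Λ₁₂^{(k)c}) ≥ r(e_k)". [cite: BalabanImbrieJaffe1988, p.311 (Sect. 5.14)] -/
def IneqW6 (P : PolymerSys) (W₆ : P.Poly → ℝ) (far : P.Poly → Prop) (θ β' : ℝ) (nbar : ℕ) : Prop :=
  (∀ X, far X → |W₆ X| ≤ θ ^ ((nbar : ℝ) + 1 + β' * P.card X)) ∧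
  (∀ X, ¬ far X → |W₆ X| ≤ θ ^ (β' * P.card X))

/-- For 0 < θ ≤ 1 the "far" bound of p. 311 is the stronger one (any β′): θ^{n̄+1+β′|X|} ≤ θ^{β′|X|} (so `IneqW6` implies the uniform bound
θ^{β′|X|} for every X). PROVED. [cite: BalabanImbrieJaffe1988, p.311 (Sect. 5.14)] -/
theorem ineqW6_uniform (P : PolymerSys) (W₆ : P.Poly → ℝ) (far : P.Poly → Prop) {θ β' : ℝ} (nbar : ℕ)
    (hθ : 0 < θ) (hθ1 : θ ≤ 1) (h : IneqW6 P W₆ far θ β' nbar) (X : P.Poly) :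
    |W₆ X| ≤ θ ^ (β' * P.card X) := by
  by_cases hX : far X
  · refine (h.1 X hX).trans ?_
    apply Real.rpow_le_rpow_of_exponent_ge hθ hθ1
    have : (0 : ℝ) ≤ nbar := Nat.cast_nonneg _
    linarith
  · exact h.2 X hX

end Literature.MathematicalPhysics.QuantumFieldTheory.BalabanImbrieJaffe1984to88.BIJ88Sect5StatementsPart2
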